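import Summits.MatrixMultiplication.OmegaCensus.STPP222IcosetCriterion
import Summits.MatrixMultiplication.OmegaCensus.STPP222IcosetHSearchSound
import Mathlib.LinearAlgebra.FiniteDimensional.Lemmas
import Mathlib.LinearAlgebra.Dimension.Constructions
import Mathlib.Data.Fin.Tuple.Sort
import Mathlib.FieldTheory.Finite.Basic

/-!
# ω-census, icoset class negatives: from an icoset STPP family in `V × H` (2-rank three) to the data the kernel search refutes

HONEST FRAMING (pub-omega census; verbatim): lottery ticket; floor = certified bounds/negative ranges.
Census STRUCTURE bookkeeping (Q7, the involution-coset class; `STPP222IcosetCriterion.lean` Pb182, engine `STPP222IcosetHSearch.lean`,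
soundness `STPP222IcosetHSearchSound.lean`), nothing about `ω`.

`Icoset.not_exists_of_check` — if `V` is a `ZMod 2`-module of `finrank 3`, `H` an abelian group correctly encoded by the code arithmetic `A`
(`IcosetH.Enc H A`) and the kernel search succeeds (`IcosetH.check A K = true`), then `V × H` carries NO involution-coset `(2,2,2)^K` STPP family.
Chain: icoset family ⇒ proper data with (T)(D)(Z) (`Icoset.Data.isSTPP_iff_of_span_eq_top`; at finrank 3 every triple's frame spans `V`) ⇒
normal form `b' = b − a − (b₀ − a₀)`, `c' = c − a − (c₀ − a₀)` (so `h(i,j,k) = 0 ⟺ b'_j + c'_k = b'_i + c'_j`), relabelling of the triples by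
`Tuple.sort` of the codes of `b'` ⇒ PLANES `⟨sA,sB⟩, ⟨sB,sC⟩, ⟨sA,sC⟩` as slot labels: pairwise different per triple by (T), and equal along every
rescued pairwise-distinct zero triple (two different planes of a 3-space span it, so an unrescued offset could be hit) ⇒ `IcosetH.Good` data,
refuted by `IcosetH.check_sound`.  Instances (the class-negative census cells) are in `STPP222IcosetClassNoneK6.lean`.
References: H. Cohn, R. Kleinberg, B. Szegedy, C. Umans, FOCS 2005 (arXiv:math/0511460), Def. 5.1.  Seat pub-omega-kernel-l4 (gen 19), 2026-08-27.
-/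

namespace Summit.MatrixMultiplication.OmegaCensus

open Literature.Computability.AlgebraicComplexity

namespace Icoset

section LinAlg

variable {V : Type*} [AddCommGroup V] [Module (ZMod 2) V]

/-- The plane spanned by two vectors. [folklore] -/
abbrev pl (u v : V) : Submodule (ZMod 2) V := Submodule.span (ZMod 2) (Set.range ![u, v])

/-- In characteristic two, `u + v = w` turns into the vanishing combination `u + v + w = 0`. [folklore] -/
theorem add_add_eq_zero_of_eq {u v w : V} (h : u + v = w) : u + v + (1 : ZMod 2) • w = 0 := by
  rw [one_smul, h, add_self_eq_zero]

/-- Membership in a plane as an explicit combination. [folklore] -/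
theorem mem_pl_iff {u v x : V} : x ∈ pl u v ↔ ∃ a b : ZMod 2, a • u + b • v = x := by
  rw [pl, Submodule.mem_span_range_iff_exists_fun]
  constructor
  · rintro ⟨c, hc⟩; exact ⟨c 0, c 1, by simpa [Fin.sum_univ_succ] using hc⟩
  · rintro ⟨a, b, h⟩; exact ⟨![a, b], by simpa [Fin.sum_univ_succ] using h⟩

/-- An `𝔽₂`-independent triple `(u, v, w)` (in the coordinate form `Indep`): `w ∉ ⟨u, v⟩`. [folklore] -/
theorem not_mem_pl_of_indep {u v w : V}
    (hI : ∀ ε₁ ε₂ ε₃ : ZMod 2, ε₁ • u + ε₂ • v + ε₃ • w = 0 → ε₁ = 0 ∧ ε₂ = 0 ∧ ε₃ = 0) : w ∉ pl u v := by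
  intro hw
  obtain ⟨a, b, h⟩ := mem_pl_iff.1 hw
  have := (hI a b 1 (add_add_eq_zero_of_eq h)).2.2
  exact one_ne_zero this

/-- Coordinate independence of `(u, v, w)` gives linear independence of the pair `![u, v]`. [folklore] -/
theorem linearIndependent_pair_of_indep {u v w : V}
    (hI : ∀ ε₁ ε₂ ε₃ : ZMod 2, ε₁ • u + ε₂ • v + ε₃ • w = 0 → ε₁ = 0 ∧ ε₂ = 0 ∧ ε₃ = 0) :
    LinearIndependent (ZMod 2) ![u, v] := by
  rw [Fintype.linearIndependent_iff]
  intro g hg i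
  have h3 := hI (g 0) (g 1) 0 (by simpa [Fin.sum_univ_succ] using hg)
  fin_cases i
  exacts [h3.1, h3.2.1]

/-- A plane spanned by an independent pair has `finrank 2`. [folklore] -/
theorem finrank_pl {u v : V} (h : LinearIndependent (ZMod 2) ![u, v]) : Module.finrank (ZMod 2) (pl u v) = 2 := by
  rw [pl, finrank_span_eq_card h]; rfl

/-- **Two different planes of a 3-space span it**: if `finrank V = 3`, `![u,v]`, `![u',v']` are independent pairs with different spans, then
every vector is an `𝔽₂`-combination of `u, v, u', v'`. [folklore] -/
theorem span_four_eq_top (hV3 : Module.finrank (ZMod 2) V = 3) {u v u' v' : V} (h : LinearIndependent (ZMod 2) ![u, v])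
    (h' : LinearIndependent (ZMod 2) ![u', v']) (hne : pl u v ≠ pl u' v') :
    Submodule.span (ZMod 2) ({u, v, u', v'} : Set V) = ⊤ := by
  -- one of `u', v'` lies outside `pl u v` (else `pl u' v' ≤ pl u v`, equal by finrank)
  have hV : FiniteDimensional (ZMod 2) V := .of_finrank_pos (by omega)
  have key : ∃ w ∈ ({u', v'} : Set V), w ∉ pl u v := by
    by_cases hu' : u' ∈ pl u v
    · by_cases hv' : v' ∈ pl u v
      · exfalso
        have hle : pl u' v' ≤ pl u v := by
          rw [pl, Submodule.span_le]
          rintro _ ⟨i, rfl⟩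
          fin_cases i
          exacts [hu', hv']
        exact hne (Submodule.eq_of_le_of_finrank_eq hle (by rw [finrank_pl h', finrank_pl h])).symm
      · exact ⟨v', by simp, hv'⟩
    · exact ⟨u', by simp, hu'⟩
  obtain ⟨w, hw, hwn⟩ := key
  have h3 : LinearIndependent (ZMod 2) (Fin.cons w ![u, v] : Fin 3 → V) := linearIndependent_finCons.2 ⟨h, hwn⟩
  have htop := h3.span_eq_top_of_card_eq_finrank (by rw [hV3]; rfl)
  rw [Fin.range_cons, Matrix.range_cons_cons_empty] at htop
  refine eq_top_iff.2 (htop ▸ Submodule.span_mono ?_)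
  intro z hz
  simp only [Set.mem_insert_iff, Set.mem_singleton_iff] at hz hw ⊢
  rcases hz with rfl | rfl | rfl
  · rcases hw with rfl | rfl
    · exact Or.inr (Or.inr (Or.inl rfl))
    · exact Or.inr (Or.inr (Or.inr rfl))
  · exact Or.inl rfl
  · exact Or.inr (Or.inl rfl)

end LinAlg

section Reduction

variable {V H : Type*} [AddCommGroup V] [Module (ZMod 2) V] [AddCommGroup H] [DecidableEq V] [DecidableEq H] {K : ℕ}
  (d : Data V H K)

namespace Data

/-- The plane of slot `s ∈ {0,1,2} = {AB, BC, AC}` of triple `t`. [folklore] -/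
def slotPlane (t : Fin K) : ℕ → Submodule (ZMod 2) V
  | 0 => pl (d.sA t) (d.sB t)
  | 1 => pl (d.sB t) (d.sC t)
  | _ => pl (d.sA t) (d.sC t)

omit [AddCommGroup H] [DecidableEq V] [DecidableEq H] in
/-- The three slot planes, by name. [folklore] -/
theorem slotPlane_eq (t : Fin K) : d.slotPlane t 0 = pl (d.sA t) (d.sB t) ∧ d.slotPlane t 1 = pl (d.sB t) (d.sC t) ∧
    d.slotPlane t 2 = pl (d.sA t) (d.sC t) := ⟨rfl, rfl, rfl⟩

omit [AddCommGroup H] [DecidableEq V] [DecidableEq H] in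
/-- (T) separates the three planes of a triple. [folklore] -/
theorem slotPlane_ne (t : Fin K) (hT : d.Indep t) :
    d.slotPlane t 0 ≠ d.slotPlane t 1 ∧ d.slotPlane t 1 ≠ d.slotPlane t 2 ∧ d.slotPlane t 0 ≠ d.slotPlane t 2 := by
  rw [(d.slotPlane_eq t).1, (d.slotPlane_eq t).2.1, (d.slotPlane_eq t).2.2]
  have hC : d.sC t ∉ pl (d.sA t) (d.sB t) := not_mem_pl_of_indep (hT)
  have hA : d.sA t ∉ pl (d.sB t) (d.sC t) :=
    not_mem_pl_of_indep fun e1 e2 e3 h => by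
      have := hT e3 e1 e2 (by rw [← h]; abel); exact ⟨this.2.1, this.2.2, this.1⟩
  refine ⟨fun h => hC ?_, fun h => hA ?_, fun h => hC ?_⟩
  · rw [h]; exact Submodule.subset_span ⟨1, rfl⟩
  · rw [h]; exact Submodule.subset_span ⟨0, rfl⟩
  · rw [h]; exact Submodule.subset_span ⟨1, rfl⟩

omit [AddCommGroup H] [DecidableEq V] [DecidableEq H] in
/-- A rescued pairwise-distinct triple forces its three planes `AB_i, BC_j, AC_k` to coincide (finrank 3). [folklore] -/
theorem planes_eq_of_rescued (hV3 : Module.finrank (ZMod 2) V = 3) (hT : ∀ t, d.Indep t) {i j k : Fin K}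
    (hR : d.Rescued i j k) : d.slotPlane i 0 = d.slotPlane j 1 ∧ d.slotPlane j 1 = d.slotPlane k 2 := by
  rw [rescued_iff_notMem_span] at hR
  rw [(d.slotPlane_eq i).1, (d.slotPlane_eq j).2.1, (d.slotPlane_eq k).2.2]
  have hslots : ∀ S : Set V, S ⊆ {d.sA i, d.sB i, d.sB j, d.sC j, d.sA k, d.sC k} →
      Submodule.span (ZMod 2) S = ⊤ → False := by
    intro S hS htop
    apply hR
    have : Submodule.span (ZMod 2) S ≤ Submodule.span (ZMod 2) (Set.range (d.slots i j k)) := by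
      apply Submodule.span_mono
      intro z hz
      have hz' := hS hz
      simp only [Set.mem_insert_iff, Set.mem_singleton_iff] at hz'
      rcases hz' with rfl | rfl | rfl | rfl | rfl | rfl
      exacts [⟨0, by simp [slots]⟩, ⟨2, by simp [slots]⟩, ⟨3, by simp [slots]⟩, ⟨4, by simp [slots]⟩, ⟨1, by simp [slots]⟩,
        ⟨5, by simp [slots]⟩]
    rw [htop, top_le_iff] at this
    rw [this]; trivial
  have hIi := linearIndependent_pair_of_indep (hT i)
  have hIj : LinearIndependent (ZMod 2) ![d.sB j, d.sC j] :=
    linearIndependent_pair_of_indep fun e1 e2 e3 h => by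
      have := hT j e3 e1 e2 (by rw [← h]; abel); exact ⟨this.2.1, this.2.2, this.1⟩
  have hIk : LinearIndependent (ZMod 2) ![d.sA k, d.sC k] :=
    linearIndependent_pair_of_indep fun e1 e2 e3 h => by
      have := hT k e1 e3 e2 (by rw [← h]; abel); exact ⟨this.1, this.2.2, this.2.1⟩
  constructor
  · by_contra hne
    refine hslots _ ?_ (span_four_eq_top hV3 hIi hIj hne)
    intro z hz; simp only [Set.mem_insert_iff, Set.mem_singleton_iff] at hz ⊢; tauto
  · by_contra hne
    refine hslots _ ?_ (span_four_eq_top hV3 hIj hIk hne)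
    intro z hz; simp only [Set.mem_insert_iff, Set.mem_singleton_iff] at hz ⊢; tauto

end Data

/-- Extension of `f : Fin K → α` to `ℕ` by a default value. [folklore] -/
def extN {α : Type*} (a : α) (f : Fin K → α) (n : ℕ) : α := if h : n < K then f ⟨n, h⟩ else a

omit [AddCommGroup V] [Module (ZMod 2) V] [AddCommGroup H] [DecidableEq V] [DecidableEq H] in
/-- `extN` on an in-range index. [folklore] -/
theorem extN_of_lt {α : Type*} (a : α) (f : Fin K → α) {n : ℕ} (h : n < K) : extN a f n = f ⟨n, h⟩ := dif_pos h

/-- **THE REDUCTION.**  At finrank 3, a successful kernel search excludes every icoset `(2,2,2)^K` STPP family in `V × H`.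
[cite: CohnKleinbergSzegedyUmans2005, Def. 5.1] -/
theorem not_exists_of_check (hV3 : Module.finrank (ZMod 2) V = 3) {A : IcosetH.CArith} (E : IcosetH.Enc H A) (hK : 1 ≤ K)
    (hcheck : IcosetH.check A K = true) :
    ¬ ∃ A B C : Fin K → Finset (V × H), IsIcosetFamily A B C ∧ IsSTPP A B C := by
  rw [exists_isIcosetFamily_isSTPP_iff]
  rintro ⟨d, hd, hT, hN⟩
  -- every frame spans `V`
  have hV : ∀ t, Submodule.span (ZMod 2) (Set.range (d.basis t)) = ⊤ := fun t =>
    ((d.indep_iff_linearIndependent t).1 (hT t)).span_eq_top_of_card_eq_finrank (by rw [hV3]; rfl)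
  obtain ⟨-, ⟨hca, hba, hbc⟩, hZ⟩ := (d.isSTPP_iff_of_span_eq_top hd hV).1 ((d.isSTPP_iff hd).2 ⟨hT, hN⟩)
  -- normal form
  set b' : Fin K → H := fun t => d.b t - d.a t - (d.b ⟨0, hK⟩ - d.a ⟨0, hK⟩) with hb'
  set c' : Fin K → H := fun t => d.c t - d.a t - (d.c ⟨0, hK⟩ - d.a ⟨0, hK⟩) with hc'
  have hb'inj : Function.Injective b' := fun s t h => hba (by
    have := congrArg (fun z => z + (d.b ⟨0, hK⟩ - d.a ⟨0, hK⟩)) h; simpa [hb'] using this)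
  have hc'inj : Function.Injective c' := fun s t h => hca (by
    have := congrArg (fun z => z + (d.c ⟨0, hK⟩ - d.a ⟨0, hK⟩)) h; simpa [hc'] using this)
  have hrel : ∀ i j k, b' j + c' k = b' i + c' j ↔ d.h i j k = 0 := by
    intro i j k
    rw [← sub_eq_zero]
    have : b' j + c' k - (b' i + c' j) = d.h i j k := by simp only [hb', hc', Data.h]; abel
    rw [this]
  have hbc' : ∀ i j, b' i + c' j = b' j + c' i → i = j := by
    intro i j h
    apply hbc
    have e : b' i - c' i = b' j - c' j := sub_eq_sub_iff_add_eq_add.2 h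
    have e2 : ∀ t, b' t - c' t = (d.b t - d.c t) - ((d.b ⟨0, hK⟩ - d.a ⟨0, hK⟩) - (d.c ⟨0, hK⟩ - d.a ⟨0, hK⟩)) := by
      intro t; simp only [hb', hc']; abel
    rw [e2, e2] at e
    exact sub_left_injective e
  -- sorting permutation
  set σ : Equiv.Perm (Fin K) := Tuple.sort (fun t => E.enc (b' t)) with hσ
  have hmono : Monotone ((fun t => E.enc (b' t)) ∘ σ) := Tuple.monotone_sort _
  have hsm : StrictMono ((fun t => E.enc (b' t)) ∘ σ) :=
    hmono.strictMono_of_injective ((E.inj.comp hb'inj).comp σ.injective)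
  have hb'0 : b' ⟨0, hK⟩ = 0 := by simp [hb']
  have hc'0 : c' ⟨0, hK⟩ = 0 := by simp [hc']
  have hσ0 : σ ⟨0, hK⟩ = ⟨0, hK⟩ := by
    have hle : E.enc (b' (σ ⟨0, hK⟩)) ≤ E.enc (b' (σ (σ.symm ⟨0, hK⟩))) :=
      hmono (show (⟨0, hK⟩ : Fin K) ≤ σ.symm ⟨0, hK⟩ from Nat.zero_le _)
    have h0 : E.enc (b' (σ (σ.symm ⟨0, hK⟩))) = 0 := by rw [Equiv.apply_symm_apply, hb'0, E.enc_zero]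
    have h1 : E.enc (b' (σ ⟨0, hK⟩)) = 0 := Nat.le_zero.1 (hle.trans_eq h0)
    exact hb'inj (E.inj (by rw [h1, hb'0, E.enc_zero]))
  -- the data for the search
  let bb : ℕ → H := extN 0 (b' ∘ σ)
  let cc : ℕ → H := extN 0 (c' ∘ σ)
  let P : ℕ → Submodule (ZMod 2) V := fun n => if h : n / 3 < K then d.slotPlane (σ ⟨n / 3, h⟩) (n % 3) else ⊥
  have hP : ∀ t (ht : t < K) (s : ℕ), s < 3 → P (3 * t + s) = d.slotPlane (σ ⟨t, ht⟩) s := by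
    intro t ht s hs
    have h1 : (3 * t + s) / 3 = t := by omega
    have h2 : (3 * t + s) % 3 = s := by omega
    simp only [P, h1, h2, dif_pos ht]
  have hP0 : ∀ t (ht : t < K), P (3 * t) = d.slotPlane (σ ⟨t, ht⟩) 0 := fun t ht => by
    simpa using hP t ht 0 (by omega)
  refine IcosetH.check_sound E hK hcheck (b := bb) (c := cc) (P := P) ?_ ?_ ⟨?_, ?_, ?_, ?_, ?_⟩
  · show extN 0 (b' ∘ σ) 0 = 0
    rw [extN_of_lt _ _ hK]; show b' (σ ⟨0, hK⟩) = 0; rw [hσ0, hb'0]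
  · show extN 0 (c' ∘ σ) 0 = 0
    rw [extN_of_lt _ _ hK]; show c' (σ ⟨0, hK⟩) = 0; rw [hσ0, hc'0]
  · intro t ht
    show E.enc (extN 0 (b' ∘ σ) t) < E.enc (extN 0 (b' ∘ σ) (t + 1))
    rw [extN_of_lt _ _ (by omega), extN_of_lt _ _ ht]
    exact hsm (Fin.mk_lt_mk.2 (Nat.lt_succ_self t))
  · intro i j hi hj h
    simp only [cc, extN_of_lt _ _ hi, extN_of_lt _ _ hj, Function.comp] at h
    exact Fin.mk.inj_iff.1 (σ.injective (hc'inj h))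
  · intro i j hi hj h
    simp only [bb, cc, extN_of_lt _ _ hi, extN_of_lt _ _ hj, Function.comp] at h
    exact Fin.mk.inj_iff.1 (σ.injective (hbc' _ _ h))
  · intro i j k hi hj hk hij hjk hik h
    simp only [bb, cc, extN_of_lt _ _ hi, extN_of_lt _ _ hj, extN_of_lt _ _ hk, Function.comp] at h
    rw [hP0 i hi, hP j hj 1 (by omega), hP k hk 2 (by omega)]
    have h0 : d.h (σ ⟨i, hi⟩) (σ ⟨j, hj⟩) (σ ⟨k, hk⟩) = 0 := (hrel _ _ _).1 h
    refine d.planes_eq_of_rescued hV3 hT (hZ _ _ _ ?_ ?_ ?_ h0)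
    · exact fun e => hij (Fin.mk.inj_iff.1 (σ.injective e))
    · exact fun e => hjk (Fin.mk.inj_iff.1 (σ.injective e))
    · exact fun e => hik (Fin.mk.inj_iff.1 (σ.injective e))
  · intro t ht
    rw [hP0 t ht, hP t ht 1 (by omega), hP t ht 2 (by omega)]
    exact d.slotPlane_ne _ (hT _)

end Reduction

end Icoset

end Summit.MatrixMultiplication.OmegaCensus
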